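import Mathlib

/-!
# Stub `stub_clusterSetPreconnected` of crux `ClusterSetConnected` (stmt-CriticalPhenomena-5769)

Model-free point-set topology (the lever S2 of the line `registered`): for any index type `ι`, a
path `p : ℝ → (ι → ℝ)` that takes values in a compact set `K` at positive times and whose every
coordinate is log-asymptotically continuous at `0⁺` (for every `i` and `ε > 0` there are `θ > 0`,
`δ₀ > 0` with `|p δ' i - p δ i| < ε` whenever `0 < δ ≤ δ' < δ₀`, `δ' ≤ (1 + θ) δ`) has a
preconnected cluster set `{g | MapClusterPt g (𝓝[>] 0) p}` in the product topology. This is the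
product-uniformity form of "the ω-limit set of a precompact asymptotically continuous orbit is
connected" (Hale 2010, Lemma 3.1.1).

Proof. The cluster set `Λ` is closed and contained in `K`, hence compact. If it is not
preconnected, it splits into two disjoint nonempty compact pieces `A`, `B`. Compactness of
`A ×ˢ B` gives finitely many coordinates `Fc` and a margin `η > 0` such that any `a ∈ A`, `b ∈ B`
differ by at least `4η` at some coordinate of `Fc` (`exists_finset_separation`). The open `η`-box
thickenings (on the coordinates `Fc`) of `A` and of `B` are therefore far apart
(`not_near_of_near`); by compactness of `K` minus their union, the path eventually, as `δ → 0⁺`,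
stays in the union (`eventually_mem_of_clusterPts_subset`). The hypothesis, made uniform over the
finitely many coordinates of `Fc` (`exists_uniform_params`), shows that the set of small times at
which the path is in the thickening of `A` (resp. `B`) is open (`isOpen_visits`); both are nonempty
(`exists_visit`: there are cluster points in `A` and in `B`), disjoint, and they cover an interval
`Ioo 0 t` — contradicting `isPreconnected_Ioo` (`false_of_separation`).
-/

open Filter Topology Set

namespace Summit.CriticalPhenomena.CardyFormulaZ2.Theorems.ClusterSetConnected

variable {ι : Type*}

/-- **Finite-coordinate separation with margin.** Two nonempty compact subsets of the product
space `ι → ℝ` without a common point are separated, with a uniform positive margin `4η`, on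
finitely many coordinates `Fc`. -/
theorem exists_finset_separation {A B : Set (ι → ℝ)} (hA : IsCompact A) (hB : IsCompact B)
    (hAne : A.Nonempty) (hBne : B.Nonempty) (hAB : ∀ a ∈ A, ∀ b ∈ B, a ≠ b) :
    ∃ (Fc : Finset ι) (η : ℝ), 0 < η ∧ ∀ a ∈ A, ∀ b ∈ B, ∃ i ∈ Fc, 4 * η ≤ |a i - b i| := by
  -- finitely many coordinates separate every pair, by compactness of `A ×ˢ B`
  have hcov : A ×ˢ B ⊆ ⋃ i : ι, {q : (ι → ℝ) × (ι → ℝ) | q.1 i ≠ q.2 i} := by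
    rintro ⟨a, b⟩ ⟨ha, hb⟩
    obtain ⟨i, hi⟩ := Function.ne_iff.1 (hAB a ha b hb)
    exact Set.mem_iUnion.2 ⟨i, hi⟩
  obtain ⟨Fc, hFc⟩ := (hA.prod hB).elim_finite_subcover
    (fun i : ι => {q : (ι → ℝ) × (ι → ℝ) | q.1 i ≠ q.2 i})
    (fun i => isOpen_ne_fun ((continuous_apply i).comp continuous_fst)
      ((continuous_apply i).comp continuous_snd)) hcov
  have hsep : ∀ a ∈ A, ∀ b ∈ B, ∃ i ∈ Fc, a i ≠ b i := by
    intro a ha b hb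
    obtain ⟨i, hi, hne⟩ := Set.mem_iUnion₂.1 (hFc (Set.mk_mem_prod ha hb))
    exact ⟨i, hi, hne⟩
  -- the continuous `D q = ∑ i ∈ Fc, |q.1 i - q.2 i|` has a positive minimum on `A ×ˢ B`
  have hDcont : Continuous fun q : (ι → ℝ) × (ι → ℝ) => ∑ i ∈ Fc, |q.1 i - q.2 i| := by
    fun_prop
  set D : (ι → ℝ) × (ι → ℝ) → ℝ := fun q => ∑ i ∈ Fc, |q.1 i - q.2 i|
  obtain ⟨q₀, hq₀, hmin⟩ := (hA.prod hB).exists_isMinOn (hAne.prod hBne) hDcont.continuousOn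
  have hm : 0 < D q₀ := by
    obtain ⟨i, hi, hne⟩ := hsep q₀.1 hq₀.1 q₀.2 hq₀.2
    have h1 : |q₀.1 i - q₀.2 i| ≤ D q₀ :=
      Finset.single_le_sum (f := fun j => |q₀.1 j - q₀.2 j|) (fun j _ => abs_nonneg _) hi
    exact (abs_pos.2 (sub_ne_zero.2 hne)).trans_le h1
  refine ⟨Fc, D q₀ / (4 * (Fc.card + 1)), div_pos hm (by positivity), fun a ha b hb => ?_⟩
  by_contra! hlt
  -- summing the strict bounds over `Fc` contradicts the minimality of `D q₀`
  have h4η : 4 * (D q₀ / (4 * ((Fc.card : ℝ) + 1))) = D q₀ / ((Fc.card : ℝ) + 1) := by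
    rw [mul_div_assoc', mul_div_mul_left _ _ (by norm_num : (4 : ℝ) ≠ 0)]
  have hsum : D (a, b) < D q₀ := by
    calc D (a, b) = ∑ i ∈ Fc, |a i - b i| := rfl
      _ ≤ ∑ _i ∈ Fc, D q₀ / ((Fc.card : ℝ) + 1) :=
          Finset.sum_le_sum fun i hi => ((hlt i hi).trans_eq h4η).le
      _ = Fc.card * (D q₀ / ((Fc.card : ℝ) + 1)) := by rw [Finset.sum_const, nsmul_eq_mul]
      _ < D q₀ := by
          rw [mul_div_assoc', div_lt_iff₀ (by positivity)]
          linarith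
  have hle : D q₀ ≤ D (a, b) := isMinOn_iff.1 hmin (a, b) (Set.mk_mem_prod ha hb)
  exact lt_irrefl _ (hsum.trans_le hle)

/-- **The two box thickenings are far apart.** If every `a ∈ A`, `b ∈ B` differ by at least `4η`
at some coordinate of `Fc`, then no point `g` that is `η`-close on `Fc` to a point `f` of the
`η`-box thickening of `A` lies in the `η`-box thickening of `B`. -/
theorem not_near_of_near {A B : Set (ι → ℝ)} {Fc : Finset ι} {η : ℝ}
    (hsep : ∀ a ∈ A, ∀ b ∈ B, ∃ i ∈ Fc, 4 * η ≤ |a i - b i|) {f g : ι → ℝ}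
    (hf : ∃ a ∈ A, ∀ i ∈ Fc, |f i - a i| < η) (hfg : ∀ i ∈ Fc, |g i - f i| < η) :
    ¬ ∃ b ∈ B, ∀ i ∈ Fc, |g i - b i| < η := by
  rintro ⟨b, hb, hgb⟩
  obtain ⟨a, ha, hfa⟩ := hf
  obtain ⟨i, hi, hab⟩ := hsep a ha b hb
  have h1 := hfa i hi
  have h2 := hfg i hi
  have h3 := hgb i hi
  have h4 : |a i - b i| ≤ |a i - f i| + |f i - b i| := abs_sub_le _ _ _
  have h5 : |f i - b i| ≤ |f i - g i| + |g i - b i| := abs_sub_le _ _ _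
  rw [abs_sub_comm (a i) (f i)] at h4
  rw [abs_sub_comm (f i) (g i)] at h5
  linarith [abs_nonneg (f i - a i)]

/-- **Uniform parameters on finitely many coordinates.** The coordinatewise
`(θ, δ₀)`-continuity hypothesis, made uniform over the finite set of coordinates `Fc`. -/
theorem exists_uniform_params {p : ℝ → ι → ℝ} {η : ℝ}
    (hp : ∀ i : ι, ∃ θ > (0 : ℝ), ∃ δ₀ > (0 : ℝ), ∀ δ δ' : ℝ,
      0 < δ → δ ≤ δ' → δ' < δ₀ → δ' ≤ (1 + θ) * δ → |p δ' i - p δ i| < η)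
    (Fc : Finset ι) :
    ∃ θ > (0 : ℝ), ∃ δ₀ > (0 : ℝ), ∀ i ∈ Fc, ∀ δ δ' : ℝ,
      0 < δ → δ ≤ δ' → δ' < δ₀ → δ' ≤ (1 + θ) * δ → |p δ' i - p δ i| < η := by
  classical
  induction Fc using Finset.induction_on with
  | empty => exact ⟨1, one_pos, 1, one_pos, fun i hi => by simp at hi⟩
  | insert j s _ ih =>
    obtain ⟨θ₁, hθ₁, δ₁, hδ₁, h₁⟩ := ih
    obtain ⟨θ₂, hθ₂, δ₂, hδ₂, h₂⟩ := hp j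
    refine ⟨min θ₁ θ₂, lt_min hθ₁ hθ₂, min δ₁ δ₂, lt_min hδ₁ hδ₂,
      fun i hi δ δ' hδ hle hlt hmul => ?_⟩
    rcases Finset.mem_insert.1 hi with rfl | hi'
    · exact h₂ δ δ' hδ hle (hlt.trans_le (min_le_right _ _))
        (hmul.trans (mul_le_mul_of_nonneg_right (add_le_add le_rfl (min_le_right _ _)) hδ.le))
    · exact h₁ i hi' δ δ' hδ hle (hlt.trans_le (min_le_left _ _))
        (hmul.trans (mul_le_mul_of_nonneg_right (add_le_add le_rfl (min_le_left _ _)) hδ.le))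

/-- An open box on finitely many coordinates of the product space `ι → ℝ`. -/
theorem isOpen_box (Fc : Finset ι) (s : ι → ℝ) (r : ℝ) :
    IsOpen {f : ι → ℝ | ∀ i ∈ Fc, |f i - s i| < r} := by
  have h : {f : ι → ℝ | ∀ i ∈ Fc, |f i - s i| < r} =
      ⋂ i ∈ Fc, {f : ι → ℝ | |f i - s i| < r} := by
    ext f
    simp only [Set.mem_setOf_eq, Set.mem_iInter]
  rw [h]
  exact isOpen_biInter_finset fun i _ =>
    isOpen_lt ((continuous_apply i).sub continuous_const).abs continuous_const

/-- The box thickening (on finitely many coordinates) of any set is open. -/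
theorem isOpen_thickening (Fc : Finset ι) (S : Set (ι → ℝ)) (r : ℝ) :
    IsOpen {f : ι → ℝ | ∃ s ∈ S, ∀ i ∈ Fc, |f i - s i| < r} := by
  have h : {f : ι → ℝ | ∃ s ∈ S, ∀ i ∈ Fc, |f i - s i| < r} =
      ⋃ s ∈ S, {f : ι → ℝ | ∀ i ∈ Fc, |f i - s i| < r} := by
    ext f
    simp only [Set.mem_setOf_eq, Set.mem_iUnion, exists_prop]
  rw [h]
  exact isOpen_biUnion fun s _ => isOpen_box Fc s r

/-- **Tail confinement.** A path with values in a compact set `K` at positive times eventually,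
as `δ → 0⁺`, stays inside any open set containing all its cluster points at `0⁺`. -/
theorem eventually_mem_of_clusterPts_subset {p : ℝ → ι → ℝ} {K W : Set (ι → ℝ)}
    (hK : IsCompact K) (hpK : ∀ δ : ℝ, 0 < δ → p δ ∈ K) (hW : IsOpen W)
    (hΛW : ∀ g, MapClusterPt g (𝓝[>] (0 : ℝ)) p → g ∈ W) :
    ∀ᶠ δ in 𝓝[>] (0 : ℝ), p δ ∈ W := by
  by_contra hnot
  have hKev : ∀ᶠ δ in 𝓝[>] (0 : ℝ), p δ ∈ K := eventually_nhdsWithin_of_forall hpK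
  have hfreq : ∃ᶠ δ in 𝓝[>] (0 : ℝ), p δ ∈ K ∩ Wᶜ :=
    (Filter.not_eventually.1 hnot).mp (hKev.mono fun δ hδK hδW => ⟨hδK, hδW⟩)
  obtain ⟨g, ⟨-, hgW⟩, hg⟩ :=
    (hK.inter_right hW.isClosed_compl).exists_mapClusterPt_of_frequently hfreq
  exact hgW (hΛW g hg)

/-- **Visits.** A cluster point `a` of the path at `0⁺` is visited, up to `η` on the finitely many
coordinates `Fc`, at some time of `Ioo 0 t`. -/
theorem exists_visit {p : ℝ → ι → ℝ} (Fc : Finset ι) {η t : ℝ} (hη : 0 < η) (ht : 0 < t)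
    {a : ι → ℝ} (ha : MapClusterPt a (𝓝[>] (0 : ℝ)) p) :
    ∃ δ ∈ Set.Ioo (0 : ℝ) t, ∀ i ∈ Fc, |p δ i - a i| < η := by
  have hbox : {f : ι → ℝ | ∀ i ∈ Fc, |f i - a i| < η} ∈ 𝓝 a :=
    (isOpen_box Fc a η).mem_nhds (by intro i _; rw [sub_self, abs_zero]; exact hη)
  have hfr := (mapClusterPt_iff_frequently.1 ha) _ hbox
  obtain ⟨δ, hδ, hδt⟩ := (hfr.and_eventually (Ioo_mem_nhdsGT ht)).exists
  exact ⟨δ, hδt, hδ⟩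

/-- **Multiplicative invariance gives openness.** A subset `S` of times whose membership is
invariant under the moves `δ ↦ δ'`, `0 < δ ≤ δ' < t`, `δ' ≤ (1 + θ) δ`, meets `Ioo 0 t` in an
open set: around `δ` it contains the interval `Ioo (δ / (1 + θ)) (min ((1 + θ) δ) t)`. -/
theorem isOpen_inter_of_invariant {S : Set ℝ} {θ t : ℝ} (hθ : 0 < θ)
    (hS : ∀ δ δ' : ℝ, 0 < δ → δ ≤ δ' → δ' < t → δ' ≤ (1 + θ) * δ → (δ ∈ S ↔ δ' ∈ S)) :
    IsOpen (Set.Ioo 0 t ∩ S) := by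
  refine isOpen_iff_forall_mem_open.2 fun δ ⟨⟨hδ0, hδt⟩, hδS⟩ => ?_
  have h1θ : (0 : ℝ) < 1 + θ := by linarith
  refine ⟨Set.Ioo (δ / (1 + θ)) (min ((1 + θ) * δ) t), ?_, isOpen_Ioo,
    div_lt_self hδ0 (by linarith), lt_min (lt_mul_of_one_lt_left hδ0 (by linarith)) hδt⟩
  rintro δ' ⟨hlo, hhi⟩
  obtain ⟨hhi1, hhi2⟩ := lt_min_iff.1 hhi
  have hδ'0 : 0 < δ' := (div_pos hδ0 h1θ).trans hlo
  refine ⟨⟨hδ'0, hhi2⟩, ?_⟩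
  rcases le_or_gt δ δ' with hle | hlt
  · exact (hS δ δ' hδ0 hle hhi2 hhi1.le).1 hδS
  · have hlo' : δ < δ' * (1 + θ) := (div_lt_iff₀ h1θ).1 hlo
    have hmul : δ ≤ (1 + θ) * δ' := by linarith
    exact (hS δ' δ hδ'0 hlt.le hδt hmul).2 hδS

/-- **The visit set of one thickening is open.** With the separation margin of
`exists_finset_separation`, the uniform parameters of `exists_uniform_params` (and `t ≤ δ₀`), and
the tail confined to the union of the two `η`-box thickenings on `Ioo 0 t`, the set of times of
`Ioo 0 t` at which the path is in the `η`-box thickening of `A` is open. -/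
theorem isOpen_visits {p : ℝ → ι → ℝ} {A B : Set (ι → ℝ)} {Fc : Finset ι} {η θ δ₀ t : ℝ}
    (hθ : 0 < θ) (htδ₀ : t ≤ δ₀)
    (hsep : ∀ a ∈ A, ∀ b ∈ B, ∃ i ∈ Fc, 4 * η ≤ |a i - b i|)
    (hgood : ∀ i ∈ Fc, ∀ δ δ' : ℝ, 0 < δ → δ ≤ δ' → δ' < δ₀ → δ' ≤ (1 + θ) * δ →
      |p δ' i - p δ i| < η)
    (hconf : ∀ δ ∈ Set.Ioo (0 : ℝ) t,
      (∃ s ∈ A, ∀ i ∈ Fc, |p δ i - s i| < η) ∨ (∃ s ∈ B, ∀ i ∈ Fc, |p δ i - s i| < η)) :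
    IsOpen (Set.Ioo 0 t ∩ {δ : ℝ | ∃ s ∈ A, ∀ i ∈ Fc, |p δ i - s i| < η}) := by
  refine isOpen_inter_of_invariant hθ fun δ δ' hδ hle hlt hmul => ?_
  have hclose : ∀ i ∈ Fc, |p δ' i - p δ i| < η := fun i hi =>
    hgood i hi δ δ' hδ hle (hlt.trans_le htδ₀) hmul
  have hclose' : ∀ i ∈ Fc, |p δ i - p δ' i| < η := fun i hi => by
    rw [abs_sub_comm]; exact hclose i hi
  constructor
  · intro hδS
    exact (hconf δ' ⟨hδ.trans_le hle, hlt⟩).resolve_right (not_near_of_near hsep hδS hclose)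
  · intro hδ'S
    exact (hconf δ ⟨hδ, hle.trans_lt hlt⟩).resolve_right (not_near_of_near hsep hδ'S hclose')

/-- **No separation.** The cluster set at `0⁺` of a path with values in the compact `K` at
positive times and coordinatewise `(θ, δ₀)`-continuous cannot be split into two nonempty compact
pieces `A`, `B` without a common point. -/
theorem false_of_separation {p : ℝ → ι → ℝ} {K : Set (ι → ℝ)} (hK : IsCompact K)
    (hpK : ∀ δ : ℝ, 0 < δ → p δ ∈ K)
    (hp : ∀ (i : ι) (ε : ℝ), 0 < ε → ∃ θ > (0 : ℝ), ∃ δ₀ > (0 : ℝ), ∀ δ δ' : ℝ,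
      0 < δ → δ ≤ δ' → δ' < δ₀ → δ' ≤ (1 + θ) * δ → |p δ' i - p δ i| < ε)
    {A B : Set (ι → ℝ)} (hA : IsCompact A) (hB : IsCompact B) (hAne : A.Nonempty)
    (hBne : B.Nonempty) (hAB : ∀ a ∈ A, ∀ b ∈ B, a ≠ b)
    (hAΛ : ∀ a ∈ A, MapClusterPt a (𝓝[>] (0 : ℝ)) p)
    (hBΛ : ∀ b ∈ B, MapClusterPt b (𝓝[>] (0 : ℝ)) p)
    (hΛ : ∀ g, MapClusterPt g (𝓝[>] (0 : ℝ)) p → g ∈ A ∪ B) : False := by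
  -- (2) finite-coordinate separation with margin
  obtain ⟨Fc, η, hη, hsep⟩ := exists_finset_separation hA hB hAne hBne hAB
  have hsep' : ∀ b ∈ B, ∀ a ∈ A, ∃ i ∈ Fc, 4 * η ≤ |b i - a i| := fun b hb a ha => by
    obtain ⟨i, hi, h⟩ := hsep a ha b hb
    exact ⟨i, hi, by rwa [abs_sub_comm]⟩
  -- (4) uniform parameters on the finitely many coordinates
  obtain ⟨θ, hθ, δ₀, hδ₀, hgood⟩ := exists_uniform_params (fun i => hp i η hη) Fc
  -- (3) tail confinement into the union of the two `η`-box thickenings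
  have hWopen : IsOpen ({f : ι → ℝ | ∃ s ∈ A, ∀ i ∈ Fc, |f i - s i| < η} ∪
      {f : ι → ℝ | ∃ s ∈ B, ∀ i ∈ Fc, |f i - s i| < η}) :=
    (isOpen_thickening Fc A η).union (isOpen_thickening Fc B η)
  have hself : ∀ s : ι → ℝ, ∀ i ∈ Fc, |s i - s i| < η := fun s i _ => by
    rw [sub_self, abs_zero]; exact hη
  have hΛW : ∀ g, MapClusterPt g (𝓝[>] (0 : ℝ)) p →
      g ∈ ({f : ι → ℝ | ∃ s ∈ A, ∀ i ∈ Fc, |f i - s i| < η} ∪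
        {f : ι → ℝ | ∃ s ∈ B, ∀ i ∈ Fc, |f i - s i| < η}) := fun g hg =>
    Or.imp (fun hgA => ⟨g, hgA, hself g⟩) (fun hgB => ⟨g, hgB, hself g⟩) (hΛ g hg)
  have htail := eventually_mem_of_clusterPts_subset hK hpK hWopen hΛW
  obtain ⟨t₁, ht₁, ht₁W⟩ := (nhdsGT_basis (0 : ℝ)).eventually_iff.1 htail
  -- shrink the time horizon below `δ₀`
  obtain ⟨t, ht0, htδ₀, htt₁⟩ : ∃ t : ℝ, 0 < t ∧ t ≤ δ₀ ∧ t ≤ t₁ :=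
    ⟨min t₁ δ₀, lt_min ht₁ hδ₀, min_le_right _ _, min_le_left _ _⟩
  have hconf : ∀ δ ∈ Set.Ioo (0 : ℝ) t,
      (∃ s ∈ A, ∀ i ∈ Fc, |p δ i - s i| < η) ∨ (∃ s ∈ B, ∀ i ∈ Fc, |p δ i - s i| < η) :=
    fun δ hδ => ht₁W ⟨hδ.1, hδ.2.trans_le htt₁⟩
  -- (5) the two visit sets are open, meet `Ioo 0 t`, cover it, and are disjoint
  have hTA : IsOpen (Set.Ioo 0 t ∩ {δ : ℝ | ∃ s ∈ A, ∀ i ∈ Fc, |p δ i - s i| < η}) :=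
    isOpen_visits hθ htδ₀ hsep hgood hconf
  have hTB : IsOpen (Set.Ioo 0 t ∩ {δ : ℝ | ∃ s ∈ B, ∀ i ∈ Fc, |p δ i - s i| < η}) :=
    isOpen_visits hθ htδ₀ hsep' hgood fun δ hδ => (hconf δ hδ).symm
  obtain ⟨a, ha⟩ := hAne
  obtain ⟨b, hb⟩ := hBne
  obtain ⟨δa, hδa, hδa'⟩ := exists_visit Fc hη ht0 (hAΛ a ha)
  obtain ⟨δb, hδb, hδb'⟩ := exists_visit Fc hη ht0 (hBΛ b hb)
  obtain ⟨δ, -, ⟨-, hδA⟩, ⟨-, hδB⟩⟩ := isPreconnected_Ioo _ _ hTA hTB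
    (fun δ hδ => Or.imp (fun h => ⟨hδ, h⟩) (fun h => ⟨hδ, h⟩) (hconf δ hδ))
    ⟨δa, hδa, hδa, a, ha, hδa'⟩ ⟨δb, hδb, hδb, b, hb, hδb'⟩
  exact not_near_of_near hsep hδA (hself (p δ)) hδB

/-- **stub_clusterSetPreconnected** (S2 of the line `registered` of crux `ClusterSetConnected`,
stmt-CriticalPhenomena-5769; pure point-set topology, model-free): for any index type `ι`, any
path `p : ℝ → (ι → ℝ)` taking values in a compact set `K` at positive times, if every coordinate
`δ ↦ p δ i` is asymptotically continuous in `log δ` at `0⁺` (the `(θ, δ₀)`-form), then the cluster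
set `{g | MapClusterPt g (𝓝[>] 0) p}` is preconnected in the product topology (product form of
"the ω-limit set of a precompact asymptotically continuous path is connected", Hale 2010,
Lemma 3.1.1). -/
theorem stub_clusterSetPreconnected :
    ∀ (ι : Type) (p : ℝ → ι → ℝ) (K : Set (ι → ℝ)), IsCompact K → (∀ δ : ℝ, 0 < δ → p δ ∈ K) →
      (∀ (i : ι) (ε : ℝ), 0 < ε → ∃ θ > (0 : ℝ), ∃ δ₀ > (0 : ℝ), ∀ δ δ' : ℝ,
        0 < δ → δ ≤ δ' → δ' < δ₀ → δ' ≤ (1 + θ) * δ → |p δ' i - p δ i| < ε) →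
      IsPreconnected {g : ι → ℝ | MapClusterPt g (nhdsWithin (0 : ℝ) (Set.Ioi 0)) p} := by
  intro ι p K hK hpK hp
  -- (0) the cluster set is closed and contained in `K`, hence compact
  have hΛK : {g : ι → ℝ | MapClusterPt g (𝓝[>] (0 : ℝ)) p} ⊆ K := fun g hg =>
    hK.isClosed.mem_of_mapClusterPt hg (eventually_nhdsWithin_of_forall hpK)
  have hΛcl : IsClosed {g : ι → ℝ | MapClusterPt g (𝓝[>] (0 : ℝ)) p} :=
    isClosed_setOf_clusterPt
  have hΛc : IsCompact {g : ι → ℝ | MapClusterPt g (𝓝[>] (0 : ℝ)) p} :=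
    hK.of_isClosed_subset hΛcl hΛK
  -- (1) a separation of the cluster set yields two disjoint nonempty compact pieces
  intro u v hu hv hcover hne₁ hne₂
  obtain ⟨a, haΛ, hau⟩ := hne₁
  obtain ⟨b, hbΛ, hbv⟩ := hne₂
  by_contra hempty
  have hnot : ∀ g, MapClusterPt g (𝓝[>] (0 : ℝ)) p → g ∈ u → g ∈ v → False :=
    fun g hg hgu hgv => hempty ⟨g, hg, hgu, hgv⟩
  refine false_of_separation hK hpK hp
    (A := {g : ι → ℝ | MapClusterPt g (𝓝[>] (0 : ℝ)) p} ∩ vᶜ)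
    (B := {g : ι → ℝ | MapClusterPt g (𝓝[>] (0 : ℝ)) p} ∩ uᶜ)
    (hΛc.inter_right hv.isClosed_compl) (hΛc.inter_right hu.isClosed_compl)
    ⟨a, haΛ, fun hav => hnot a haΛ hau hav⟩ ⟨b, hbΛ, fun hbu => hnot b hbΛ hbu hbv⟩
    (fun x hx y hy hxy => ?_) (fun x hx => hx.1) (fun x hx => hx.1) (fun g hg => ?_)
  · subst hxy
    exact Or.elim (hcover hx.1) hy.2 hx.2
  · exact Or.elim (hcover hg) (fun hgu => Or.inl ⟨hg, fun hgv => hnot g hg hgu hgv⟩)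
      (fun hgv => Or.inr ⟨hg, fun hgu => hnot g hg hgu hgv⟩)

end Summit.CriticalPhenomena.CardyFormulaZ2.Theorems.ClusterSetConnected
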